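import Literature.Geometry.Lorentzian.VolumeChartIntegral
import Literature.Geometry.Lorentzian.HopfPositivity
import Mathlib.Algebra.Order.Chebyshev
import HarnessLib

/-!
# Comparison of the Riemannian measure and of `h⁻¹(df, df)` with their Euclidean counterparts
# on compact parts of a chart

Infrastructure for Sobolev and Poincaré inequalities on Riemannian manifolds obtained by
transplanting the Euclidean ones chart by chart (Schoen–Yau 1979, proof of Lemma 3.1: "`ds²` is
uniformly equivalent to the Euclidean metric", p. 63; Hebey 1999, §2–3; Aubin 1998, §2.6): on a
compact part `K` of the target of the extended chart `φ = extChartAt I x` of a manifold `N`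
modelled on `ℝᴺ` with a smooth Riemannian metric `h`,

* `exists_sqrt_det_chartGramMatrix_bounds` — the density of the Riemannian measure is pinched,
  `0 < λ ≤ √(det h_{ij}(y)) ≤ Λ` for `y ∈ K` (it is continuous and positive,
  `VolumeChartIntegral.lean`);
* `exists_innerDual_mvfderiv_bounds` — the Dirichlet integrand is uniformly equivalent to the
  Euclidean one, `λ' ‖D(f ∘ φ⁻¹)(y)‖² ≤ h⁻¹(df, df)(φ⁻¹ y) ≤ Λ' ‖D(f ∘ φ⁻¹)(y)‖²` for `y ∈ K` and
  every `f` differentiable at `φ⁻¹ y` (the coordinate expression `h⁻¹(df,df) = ∑ hⁱʲ ∂ᵢf̂ ∂ⱼf̂`,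
  `ChartLaplacian.lean`, with `(hⁱʲ)` continuous and positive definite, hence uniformly elliptic
  and bounded on `K`, `HopfPositivity.exists_uniformlyElliptic_of_continuousOn`);
* `setLIntegral_source_inter_preimage_extChartAt` — the chart formula for integrals over the part
  `φ.source ∩ φ⁻¹ Q` of the chart domain over a measurable `Q ⊆ φ.target`:
  `∫_{φ⁻¹ Q} g(φ p) dμ_h = ∫_Q g(y) √(det h_{ij}(y)) dy` (from `setLIntegral_extChartAt_comp`).

All statements are proved; no named facts are introduced.

## References

* R. Schoen, S.-T. Yau, Comm. Math. Phys. 65 (1979) 45–76, proof of Lemma 3.1 (p. 63).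
* E. Hebey, *Nonlinear Analysis on Manifolds: Sobolev Spaces and Inequalities*, Courant LN 5
  (1999), §2.2 and Thm. 3.6 ff. (Sobolev embeddings via charts).
* I. Chavel, *Riemannian Geometry*, 2nd ed. (2006), §III.3 (the Riemannian measure in a chart).
-/

noncomputable section

open Set Function Filter Metric MeasureTheory Measure TopologicalSpace Manifold Bundle Module
open scoped Topology Manifold ContDiff ENNReal NNReal Matrix

namespace Literature.Geometry.Lorentzian

/-! ### Covectors and quadratic forms on `ℝᴺ` -/

section Algebra

variable {N : ℕ}

/-- A single entry is bounded by the sum of the absolute values of all entries. [folklore] -/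
private theorem abs_entry_le_sum₂' (a : Fin N → Fin N → ℝ) (i j : Fin N) :
    |a i j| ≤ ∑ i', ∑ j', |a i' j'| := by
  calc |a i j| ≤ ∑ j', |a i j'| :=
        Finset.single_le_sum (f := fun j' ↦ |a i j'|) (fun _ _ ↦ abs_nonneg _) (Finset.mem_univ j)
    _ ≤ ∑ i', ∑ j', |a i' j'| :=
        Finset.single_le_sum (f := fun i' ↦ ∑ j', |a i' j'|)
          (fun _ _ ↦ Finset.sum_nonneg fun _ _ ↦ abs_nonneg _) (Finset.mem_univ i)

/-- The quadratic form of a real matrix: `x ⬝ᵥ (A *ᵥ x) = ∑ᵢⱼ Aᵢⱼ xᵢ xⱼ`. [folklore] -/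
private theorem dotProduct_mulVec_eq_sum' (A : Matrix (Fin N) (Fin N) ℝ) (x : Fin N → ℝ) :
    x ⬝ᵥ (A *ᵥ x) = ∑ i, ∑ j, A i j * x i * x j := by
  simp only [dotProduct, Matrix.mulVec, Finset.mul_sum]
  refine Finset.sum_congr rfl fun i _ ↦ Finset.sum_congr rfl fun j _ ↦ ?_
  ring

/-- **The operator norm of a covector on `ℝᴺ` is at most the `ℓ²`-norm of its components**:
`‖f‖² ≤ ∑ₖ f(eₖ)²` (Cauchy–Schwarz after expanding `ξ = ∑ ξₖ eₖ`). [folklore] -/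
theorem norm_sq_le_sum_sq_apply_single (f : EuclideanSpace ℝ (Fin N) →L[ℝ] ℝ) :
    ‖f‖ ^ 2 ≤ ∑ k, (f (EuclideanSpace.single k 1)) ^ 2 := by
  have hS : 0 ≤ ∑ k, (f (EuclideanSpace.single k 1)) ^ 2 := Finset.sum_nonneg fun _ _ ↦ sq_nonneg _
  have hbound : ‖f‖ ≤ Real.sqrt (∑ k, (f (EuclideanSpace.single k 1)) ^ 2) := by
    refine ContinuousLinearMap.opNorm_le_bound _ (Real.sqrt_nonneg _) fun ξ ↦ ?_
    have hexp : f ξ = ∑ k, ξ k * f (EuclideanSpace.single k 1) := by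
      conv_lhs => rw [← (EuclideanSpace.basisFun (Fin N) ℝ).sum_repr' ξ]
      simp only [_root_.map_sum, map_smul, smul_eq_mul, EuclideanSpace.basisFun_apply,
        EuclideanSpace.inner_single_left, map_one, one_mul]
    rw [hexp, Real.norm_eq_abs]
    have hcs := Finset.sum_mul_sq_le_sq_mul_sq Finset.univ (fun k ↦ ξ k)
      (fun k ↦ f (EuclideanSpace.single k 1))
    have hξ : ∑ k, ξ k ^ 2 = ‖ξ‖ ^ 2 := (EuclideanSpace.real_norm_sq_eq ξ).symm
    rw [hξ] at hcs
    have h2 : |∑ k, ξ k * f (EuclideanSpace.single k 1)| ^ 2 ≤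
        (Real.sqrt (∑ k, (f (EuclideanSpace.single k 1)) ^ 2) * ‖ξ‖) ^ 2 := by
      rw [sq_abs, mul_pow, Real.sq_sqrt hS, mul_comm]
      exact hcs
    exact abs_le_of_sq_le_sq' h2 (by positivity) |>.2
  nlinarith [Real.sq_sqrt hS, norm_nonneg f,
    Real.sqrt_nonneg (∑ k, (f (EuclideanSpace.single k 1)) ^ 2)]

/-- Each component of a covector is bounded by its operator norm: `f(eₖ)² ≤ ‖f‖²`. [folklore] -/
theorem sq_apply_single_le (f : EuclideanSpace ℝ (Fin N) →L[ℝ] ℝ) (k : Fin N) :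
    (f (EuclideanSpace.single k 1)) ^ 2 ≤ ‖f‖ ^ 2 := by
  have h := f.le_opNorm (EuclideanSpace.single k 1)
  have hek : ‖(EuclideanSpace.single k (1 : ℝ) : EuclideanSpace ℝ (Fin N))‖ = 1 := by simp
  rw [hek, mul_one, Real.norm_eq_abs] at h
  exact sq_le_sq' (abs_le.1 h).1 (abs_le.1 h).2

/-- `∑ₖ f(eₖ)² ≤ N ‖f‖²`. [folklore] -/
theorem sum_sq_apply_single_le (f : EuclideanSpace ℝ (Fin N) →L[ℝ] ℝ) :
    ∑ k, (f (EuclideanSpace.single k 1)) ^ 2 ≤ N * ‖f‖ ^ 2 := by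
  calc ∑ k, (f (EuclideanSpace.single k 1)) ^ 2 ≤ ∑ _k : Fin N, ‖f‖ ^ 2 :=
        Finset.sum_le_sum fun k _ ↦ sq_apply_single_le f k
    _ = N * ‖f‖ ^ 2 := by simp

/-- **A quadratic form with bounded coefficients is bounded**: if `|A_{ij}| ≤ C` then
`∑ᵢ ∑ⱼ A_{ij} aᵢ aⱼ ≤ C N ∑ₖ aₖ²` (via `(∑ |aₖ|)² ≤ N ∑ aₖ²`). [folklore] -/
theorem quadForm_le_of_abs_le {A : Matrix (Fin N) (Fin N) ℝ} {C : ℝ} (hC : ∀ i j, |A i j| ≤ C)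
    (a : Fin N → ℝ) : ∑ i, ∑ j, A i j * a i * a j ≤ C * N * ∑ k, a k ^ 2 := by
  rcases Nat.eq_zero_or_pos N with hN | hN
  · subst hN
    simp
  have hC0 : 0 ≤ C := (abs_nonneg _).trans (hC ⟨0, hN⟩ ⟨0, hN⟩)
  have h1 : ∑ i, ∑ j, A i j * a i * a j ≤ C * (∑ k, |a k|) ^ 2 := by
    calc ∑ i, ∑ j, A i j * a i * a j ≤ ∑ i, ∑ j, C * (|a i| * |a j|) := by
          refine Finset.sum_le_sum fun i _ ↦ Finset.sum_le_sum fun j _ ↦ ?_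
          calc A i j * a i * a j ≤ |A i j * a i * a j| := le_abs_self _
            _ = |A i j| * (|a i| * |a j|) := by rw [abs_mul, abs_mul, mul_assoc]
            _ ≤ C * (|a i| * |a j|) := mul_le_mul_of_nonneg_right (hC i j) (by positivity)
      _ = C * (∑ k, |a k|) ^ 2 := by
          rw [sq, Finset.sum_mul_sum, Finset.mul_sum]
          refine Finset.sum_congr rfl fun i _ ↦ ?_
          rw [Finset.mul_sum]
  have hcs : (∑ k, |a k|) ^ 2 ≤ N * ∑ k, a k ^ 2 := by
    have h := sq_sum_le_card_mul_sum_sq (s := Finset.univ) (f := fun k : Fin N ↦ |a k|)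
    simp only [Finset.card_univ, Fintype.card_fin, sq_abs] at h
    exact_mod_cast h
  calc ∑ i, ∑ j, A i j * a i * a j ≤ C * (∑ k, |a k|) ^ 2 := h1
    _ ≤ C * (N * ∑ k, a k ^ 2) := mul_le_mul_of_nonneg_left hcs hC0
    _ = C * N * ∑ k, a k ^ 2 := by ring

end Algebra

/-! ### The chart formula over parts of the chart domain -/

section SubTarget

variable {H : Type*} [TopologicalSpace H] {n : ℕ∞ω} {m : ℕ}
  {I : ModelWithCorners ℝ (EuclideanSpace ℝ (Fin m)) H}
  {N : Type*} [TopologicalSpace N] [ChartedSpace H N] [IsManifold I 1 N]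
  [T3Space N] [MeasurableSpace N] [BorelSpace N]
  (h : ContMDiffRiemannianMetric I n (EuclideanSpace ℝ (Fin m)) (TangentSpace I : N → Type _))
  (x : N)

/-- **The chart formula over a part of the chart domain** (Lebesgue integral): for a measurable
`Q ⊆ φ.target`, `φ = extChartAt I x`, and `g ≥ 0` a.e.-measurable on the target,
`∫_{φ.source ∩ φ⁻¹ Q} g(φ p) dμ_h = ∫_Q g(y) √(det h_{ij}(y)) dy`. Chavel 2006, §III.3, (III.3.6).
[cite: Chavel2006, §III.3 (III.3.6)] -/
theorem setLIntegral_source_inter_preimage_extChartAt {g : EuclideanSpace ℝ (Fin m) → ℝ≥0∞}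
    (hg : AEMeasurable g ((volume : Measure (EuclideanSpace ℝ (Fin m))).restrict
      (extChartAt I x).target))
    {Q : Set (EuclideanSpace ℝ (Fin m))} (hQm : MeasurableSet Q) (hQ : Q ⊆ (extChartAt I x).target) :
    ∫⁻ p in (extChartAt I x).source ∩ extChartAt I x ⁻¹' Q, g (extChartAt I x p) ∂riemannianMeasure h =
      ∫⁻ y in Q, g y * ENNReal.ofReal (Real.sqrt (chartGramMatrix h x y).det) := by
  have hs : MeasurableSet (extChartAt I x).source := (isOpen_extChartAt_source x).measurableSet
  have hSQ : MeasurableSet ((extChartAt I x).source ∩ extChartAt I x ⁻¹' Q) :=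
    measurableSet_source_inter_preimage_extChartAt x hQm
  -- the left-hand side as an integral of `(1_Q g) ∘ φ` over the whole chart domain
  have h1 : ∫⁻ p in (extChartAt I x).source ∩ extChartAt I x ⁻¹' Q, g (extChartAt I x p)
      ∂riemannianMeasure h =
      ∫⁻ p in (extChartAt I x).source, Q.indicator g (extChartAt I x p) ∂riemannianMeasure h := by
    rw [← lintegral_indicator hSQ, ← lintegral_indicator hs]
    refine lintegral_congr fun p ↦ ?_
    by_cases hp : p ∈ (extChartAt I x).source
    · rw [indicator_of_mem hp]
      by_cases hq : extChartAt I x p ∈ Q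
      · rw [indicator_of_mem (show p ∈ _ ∩ _ from ⟨hp, hq⟩), indicator_of_mem hq]
      · rw [indicator_of_notMem (fun h' ↦ hq h'.2), indicator_of_notMem hq]
    · rw [indicator_of_notMem (fun h' ↦ hp h'.1), indicator_of_notMem hp]
  rw [h1, setLIntegral_extChartAt_comp h x (hg.indicator hQm)]
  -- the right-hand side
  have h2 : ∀ y, Q.indicator g y * ENNReal.ofReal (Real.sqrt (chartGramMatrix h x y).det) =
      Q.indicator (fun y ↦ g y * ENNReal.ofReal (Real.sqrt (chartGramMatrix h x y).det)) y := by
    intro y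
    by_cases hy : y ∈ Q
    · rw [indicator_of_mem hy, indicator_of_mem hy]
    · rw [indicator_of_notMem hy, indicator_of_notMem hy, zero_mul]
  simp_rw [h2]
  rw [lintegral_indicator hQm, Measure.restrict_restrict hQm, inter_eq_left.2 hQ]

/-- **The chart formula over a part of the chart domain, for a function on the manifold**:
for a measurable `u : N → [0, ∞]` and a measurable `Q ⊆ φ.target`,
`∫_{φ.source ∩ φ⁻¹ Q} u dμ_h = ∫_Q u(φ⁻¹ y) √(det h_{ij}(y)) dy`. [cite: Chavel2006, §III.3 (III.3.6)] -/
theorem setLIntegral_source_inter_preimage_extChartAt' {u : N → ℝ≥0∞} (hu : Measurable u)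
    {Q : Set (EuclideanSpace ℝ (Fin m))} (hQm : MeasurableSet Q) (hQ : Q ⊆ (extChartAt I x).target) :
    ∫⁻ p in (extChartAt I x).source ∩ extChartAt I x ⁻¹' Q, u p ∂riemannianMeasure h =
      ∫⁻ y in Q, u ((extChartAt I x).symm y) * ENNReal.ofReal (Real.sqrt (chartGramMatrix h x y).det) := by
  have hSQ : MeasurableSet ((extChartAt I x).source ∩ extChartAt I x ⁻¹' Q) :=
    measurableSet_source_inter_preimage_extChartAt x hQm
  have h1 : ∫⁻ p in (extChartAt I x).source ∩ extChartAt I x ⁻¹' Q, u p ∂riemannianMeasure h =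
      ∫⁻ p in (extChartAt I x).source ∩ extChartAt I x ⁻¹' Q,
        (u ∘ (extChartAt I x).symm) (extChartAt I x p) ∂riemannianMeasure h :=
    setLIntegral_congr_fun hSQ (fun p hp ↦ by
      simp only [Function.comp_apply, (extChartAt I x).left_inv hp.1])
  rw [h1, setLIntegral_source_inter_preimage_extChartAt h x
    (hu.comp_aemeasurable (aemeasurable_extChartAt_symm_restrict x)) hQm hQ]
  rfl

omit [T3Space N] [MeasurableSpace N] [BorelSpace N] in
/-- **The Riemannian density is pinched on compact parts of the chart target**: for a compact
`K ⊆ φ.target` there are `0 < λ ≤ Λ` with `λ ≤ √(det h_{ij}(y)) ≤ Λ` for all `y ∈ K` (continuity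
and positivity of the density, `VolumeChartIntegral.lean`). [folklore] -/
theorem exists_sqrt_det_chartGramMatrix_bounds {K : Set (EuclideanSpace ℝ (Fin m))}
    (hK : IsCompact K) (hKt : K ⊆ (extChartAt I x).target) :
    ∃ lam Lam : ℝ, 0 < lam ∧ lam ≤ Lam ∧ ∀ y ∈ K,
      lam ≤ Real.sqrt (chartGramMatrix h x y).det ∧ Real.sqrt (chartGramMatrix h x y).det ≤ Lam := by
  have hc : ContinuousOn (fun y ↦ Real.sqrt (chartGramMatrix h x y).det) K :=
    (continuousOn_sqrt_det_chartGramMatrix h x).mono hKt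
  by_cases hne : K.Nonempty
  · obtain ⟨y₀, hy₀, hmin⟩ := hK.exists_isMinOn hne hc
    obtain ⟨y₁, hy₁, hmax⟩ := hK.exists_isMaxOn hne hc
    refine ⟨Real.sqrt (chartGramMatrix h x y₀).det, Real.sqrt (chartGramMatrix h x y₁).det,
      sqrt_det_chartGramMatrix_pos h x (hKt hy₀), hmin hy₁, fun y hy ↦ ⟨hmin hy, hmax hy⟩⟩
  · refine ⟨1, 1, one_pos, le_rfl, fun y hy ↦ absurd ⟨y, hy⟩ hne⟩

end SubTarget

/-! ### `h⁻¹(df, df)` versus `‖D(f ∘ φ⁻¹)‖²` on compact parts of the chart target -/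

section Gradient

variable {N : ℕ} {M : Type*} [TopologicalSpace M] [ChartedSpace (EuclideanSpace ℝ (Fin N)) M]
  [IsManifold (𝓡 N) ∞ M]
  (h : ContMDiffRiemannianMetric (𝓡 N) ∞ (EuclideanSpace ℝ (Fin N)) (TangentSpace (𝓡 N) : M → Type _))
  (x : M)

/-- **`h⁻¹(df, df)` is uniformly equivalent to `‖D(f ∘ φ⁻¹)‖²` on compact parts of a chart**
(`φ = extChartAt (𝓡 N) x`): for a compact `K ⊆ φ.target` there are `0 < λ' ≤ Λ'` such that for
every `y ∈ K` and every `f : M → ℝ` differentiable at `φ⁻¹ y`,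
`λ' ‖D(f ∘ φ⁻¹)(y)‖² ≤ h⁻¹(df, df)(φ⁻¹ y) ≤ Λ' ‖D(f ∘ φ⁻¹)(y)‖²`. In the chart,
`h⁻¹(df, df) = ∑ᵢⱼ hⁱʲ ∂ᵢf̂ ∂ⱼf̂` (`innerDual_mvfderiv_eq_sum_localFrame`) with `(hⁱʲ)` the inverse
Gram matrix of the coordinate frame — continuous and positive definite on the target, hence
uniformly elliptic (`exists_uniformlyElliptic_of_continuousOn`) and bounded on `K` —, and
`‖Df̂‖² ≤ ∑ₖ (∂ₖf̂)² ≤ N ‖Df̂‖²`. This is the "uniform equivalence of `ds²` with the Euclidean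
metric" on coordinate balls (Schoen–Yau 1979, p. 63; Hebey 1999, §2.2).
[cite: SchoenYauPMT1979, proof of Lemma 3.1 (p. 63)] -/
theorem exists_innerDual_mvfderiv_bounds {K : Set (EuclideanSpace ℝ (Fin N))}
    (hK : IsCompact K) (hKt : K ⊆ (extChartAt (𝓡 N) x).target) :
    ∃ lam Lam : ℝ, 0 < lam ∧ lam ≤ Lam ∧ ∀ y ∈ K, ∀ f : M → ℝ,
      MDifferentiableAt (𝓡 N) 𝓘(ℝ, ℝ) f ((extChartAt (𝓡 N) x).symm y) →
      lam * ‖fderiv ℝ (f ∘ (extChartAt (𝓡 N) x).symm) y‖ ^ 2 ≤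
        (PseudoRiemannianMetric.ofRiemannian h).innerDual ((extChartAt (𝓡 N) x).symm y)
          (mvfderiv (𝓡 N) f ((extChartAt (𝓡 N) x).symm y)).toLinearMap
          (mvfderiv (𝓡 N) f ((extChartAt (𝓡 N) x).symm y)).toLinearMap ∧
      (PseudoRiemannianMetric.ofRiemannian h).innerDual ((extChartAt (𝓡 N) x).symm y)
          (mvfderiv (𝓡 N) f ((extChartAt (𝓡 N) x).symm y)).toLinearMap
          (mvfderiv (𝓡 N) f ((extChartAt (𝓡 N) x).symm y)).toLinearMap ≤
        Lam * ‖fderiv ℝ (f ∘ (extChartAt (𝓡 N) x).symm) y‖ ^ 2 := by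
  classical
  set g := PseudoRiemannianMetric.ofRiemannian h with hg
  have hgR : g.IsRiemannian := PseudoRiemannianMetric.isRiemannian_ofRiemannian h
  set ψ := extChartAt (𝓡 N) x with hψ
  set T : Set (EuclideanSpace ℝ (Fin N)) := ψ.target with hT
  have hTo : IsOpen T := isOpen_extChartAt_target x
  set b : Module.Basis (Fin N) ℝ (EuclideanSpace ℝ (Fin N)) :=
    (EuclideanSpace.basisFun (Fin N) ℝ).toBasis with hb
  have hbi : ∀ i, b i = EuclideanSpace.single i 1 := fun i ↦ by
    rw [hb, OrthonormalBasis.coe_toBasis, EuclideanSpace.basisFun_apply]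
  set Fr := (trivializationAt (EuclideanSpace ℝ (Fin N)) (TangentSpace (𝓡 N)) x).localFrame b
    with hFr
  set Gf : EuclideanSpace ℝ (Fin N) → Fin N → Fin N → ℝ := fun y i j ↦
    g.val (ψ.symm y) (Fr i (ψ.symm y)) (Fr j (ψ.symm y)) with hGf
  set A : EuclideanSpace ℝ (Fin N) → Matrix (Fin N) (Fin N) ℝ := fun y ↦ (Matrix.of (Gf y))⁻¹
    with hA
  have hsrc : ∀ y ∈ T, ψ.symm y ∈ (chartAt (EuclideanSpace ℝ (Fin N)) x).source := fun y hy ↦ by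
    rw [← extChartAt_source (𝓡 N)]
    exact ψ.map_target hy
  -- (1) the coordinate formula
  have hformula : ∀ y ∈ T, ∀ f : M → ℝ, MDifferentiableAt (𝓡 N) 𝓘(ℝ, ℝ) f (ψ.symm y) →
      g.innerDual (ψ.symm y) (mvfderiv (𝓡 N) f (ψ.symm y)).toLinearMap
        (mvfderiv (𝓡 N) f (ψ.symm y)).toLinearMap =
      ∑ i, ∑ j, A y i j * fderiv ℝ (f ∘ ψ.symm) y (EuclideanSpace.single i 1) *
        fderiv ℝ (f ∘ ψ.symm) y (EuclideanSpace.single j 1) := by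
    intro y hy f hf
    have h1 := innerDual_mvfderiv_eq_sum_localFrame g b (hsrc y hy) hf hf
      (uh := f ∘ ψ.symm) (vh := f ∘ ψ.symm) Filter.EventuallyEq.rfl Filter.EventuallyEq.rfl
    rw [ψ.right_inv hy] at h1
    rw [h1]
    simp only [hbi, hA, hGf, hFr]
  -- (2) pointwise ellipticity: `A = Ĝ⁻¹` is positive definite on `T`
  have hApos : ∀ y ∈ T, ∀ ξ : EuclideanSpace ℝ (Fin N), ξ ≠ 0 →
      0 < ∑ i, ∑ j, A y i j * ξ i * ξ j := by
    intro y hy ξ hξ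
    have hpe : ψ.symm y ∈
        (trivializationAt (EuclideanSpace ℝ (Fin N)) (TangentSpace (𝓡 N)) x).baseSet := by
      simpa using hsrc y hy
    set β := (trivializationAt (EuclideanSpace ℝ (Fin N)) (TangentSpace (𝓡 N)) x).basisAt b hpe
      with hβ
    have hFrβ : ∀ i, Fr i (ψ.symm y) = β i := fun i ↦
      Trivialization.localFrame_apply_of_mem_baseSet _ b hpe
    have hGpos : (Matrix.of (Gf y)).PosDef := by
      refine Matrix.PosDef.of_dotProduct_mulVec_pos ?_ fun v hv ↦ ?_
      · ext i j
        simp only [Matrix.conjTranspose_apply, Matrix.of_apply, star_trivial, hGf]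
        exact g.symm _ _ _
      · have h : star v ⬝ᵥ ((Matrix.of (Gf y)) *ᵥ v) =
            g.val (ψ.symm y) (∑ i, v i • β i) (∑ j, v j • β j) := by
          rw [star_trivial, dotProduct_mulVec_eq_sum']
          simp only [Matrix.of_apply, hGf, hFrβ, _root_.map_sum, map_smul,
            _root_.sum_apply, _root_.smul_apply, smul_eq_mul,
            Finset.mul_sum]
          refine Finset.sum_congr rfl fun i _ ↦ Finset.sum_congr rfl fun j _ ↦ ?_
          rw [g.symm _ (β j) (β i)]
          ring
        rw [h]
        refine hgR _ _ fun h0 ↦ hv ?_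
        funext i
        exact Fintype.linearIndependent_iff.1 β.linearIndependent v h0 i
    have hAy : (A y).PosDef := hGpos.inv
    have hx : (ξ : Fin N → ℝ) ≠ 0 := fun h ↦ hξ (by
      ext i
      exact congrFun h i)
    have := hAy.dotProduct_mulVec_pos hx
    rwa [star_trivial, dotProduct_mulVec_eq_sum'] at this
  -- (3) continuity of `A` on `T`
  have hGs : ∀ i j, ContDiffOn ℝ ∞ (fun y ↦ Gf y i j) T := fun i j ↦
    contDiffOn_gram_comp_extChartAt_symm b g i j
  have hAc : ∀ i j, ContinuousOn (fun y ↦ A y i j) T := by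
    intro i j y hy
    have h := contMDiffAt_matrix_inv (I := 𝓘(ℝ, EuclideanSpace ℝ (Fin N))) (k := ∞)
      (A := fun y ↦ Matrix.of (Gf y)) (x₀ := y)
      (fun i j ↦ contMDiffAt_iff_contDiffAt.2 ((hGs i j).contDiffAt (hTo.mem_nhds hy)))
      (det_gram_comp_extChartAt_symm_ne_zero b g hy) i j
    exact (contMDiffAt_iff_contDiffAt.1 h).continuousAt.continuousWithinAt
  -- (4) uniform ellipticity and boundedness on `K`
  obtain ⟨μ, hμ, hell⟩ := exists_uniformlyElliptic_of_continuousOn hK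
    (a := fun y i j ↦ A y i j) (fun i j ↦ (hAc i j).mono hKt)
    (fun y hy ξ hξ ↦ hApos y (hKt hy) ξ hξ)
  have hS : ContinuousOn (fun y ↦ ∑ i, ∑ j, |A y i j|) K :=
    continuousOn_finsetSum _ fun i _ ↦ continuousOn_finsetSum _ fun j _ ↦
      continuous_abs.comp_continuousOn ((hAc i j).mono hKt)
  obtain ⟨C, hC⟩ := hK.exists_bound_of_continuousOn hS
  have hCA : ∀ y ∈ K, ∀ i j, |A y i j| ≤ C := by
    intro y hy i j
    have h := (le_abs_self _).trans (Real.norm_eq_abs _ ▸ hC y hy)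
    exact (abs_entry_le_sum₂' (A y) i j).trans h
  refine ⟨μ, max μ (C * N * N), hμ, le_max_left _ _, fun y hy f hf ↦ ?_⟩
  have hyT : y ∈ T := hKt hy
  rw [hformula y hyT f hf]
  set a : Fin N → ℝ := fun i ↦ fderiv ℝ (f ∘ ψ.symm) y (EuclideanSpace.single i 1) with ha
  set ξ : EuclideanSpace ℝ (Fin N) := WithLp.toLp 2 a with hξ
  have hξi : ∀ i, ξ i = a i := fun i ↦ rfl
  have hξn : ‖ξ‖ ^ 2 = ∑ k, a k ^ 2 := by
    rw [EuclideanSpace.real_norm_sq_eq]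
  have hlow := norm_sq_le_sum_sq_apply_single (fderiv ℝ (f ∘ ψ.symm) y)
  have hup := sum_sq_apply_single_le (fderiv ℝ (f ∘ ψ.symm) y)
  constructor
  · have h1 := hell y hy ξ
    simp only [hξi] at h1
    rw [hξn] at h1
    calc μ * ‖fderiv ℝ (f ∘ ψ.symm) y‖ ^ 2 ≤ μ * ∑ k, a k ^ 2 :=
          mul_le_mul_of_nonneg_left hlow hμ.le
      _ ≤ _ := h1
  · have h2 := quadForm_le_of_abs_le (hCA y hy) a
    have hC0' : 0 ≤ C * N := by
      have : 0 ≤ C := by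
        by_cases hN : N = 0
        · have h' := hC y hy
          simp only [Real.norm_eq_abs] at h'
          exact (abs_nonneg _).trans h'
        · obtain ⟨i⟩ : Nonempty (Fin N) := Fin.pos_iff_nonempty.1 (Nat.pos_of_ne_zero hN)
          exact (abs_nonneg _).trans (hCA y hy i i)
      positivity
    calc ∑ i, ∑ j, A y i j * a i * a j ≤ C * N * ∑ k, a k ^ 2 := h2
      _ ≤ C * N * (N * ‖fderiv ℝ (f ∘ ψ.symm) y‖ ^ 2) := mul_le_mul_of_nonneg_left hup hC0'
      _ = C * N * N * ‖fderiv ℝ (f ∘ ψ.symm) y‖ ^ 2 := by ring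
      _ ≤ max μ (C * N * N) * ‖fderiv ℝ (f ∘ ψ.symm) y‖ ^ 2 :=
          mul_le_mul_of_nonneg_right (le_max_right _ _) (sq_nonneg _)

end Gradient

end Literature.Geometry.Lorentzian

end
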